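import Summits.ABC.StewartYu.PadicW80SizesLB
import Summits.ABC.StewartYu.PadicCW77Sizes
import Summits.ABC.StewartYu.PadicCW77Junctions
import Summits.ABC.StewartYu.PadicW80BudgetsL
import Summits.ABC.StewartYu.PadicW80ParLF
import HarnessLib

/-!
# The archimedean sizes at the `(log p)`-normalised parameter record, III (twin of p3's `PadicW80SizesC` on `PadicW80ParL`; cell abc-stewartyu, p1 stub S5)

`Summits/ABC/StewartYu/PadicW80SizesC.lean` — continuation of `PadicW80Sizes(B).lean` (cell
`abc-stewartyu`, seat p3; theorems only): for `S : CW77.Setup` under `hy : S.SizeHyp P.V P.Vθ P.W`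
at p1's parameters,

* `abs_Dclear_qTerm_le_p` — Siegel's coefficient bound `|D(s,τ)·qTerm₀(u,τ,s)| ≤ 𝔅⁴E(2)` on the
  box of level `0`, `s < S₀`, `|τ| < T` (`E(c) = exp(c·𝔘/(2c_L'))`);
* `abs_qTerm_le_p` — the archimedean half of the `p`-adic Liouville step:
  `|qTerm_J(u,τ,s)| ≤ 𝔅²E(2^{k+1})` on the box of level `J ≤ J₀`, `|τ| ≤ T`, `s < 2^{k+1+J}S₀`;
* `DclearJ_le_p` (`D_J(s,τ) ≤ 𝔅²E(2^{k+1})`), `abs_rHalf_le_p`, `Dhalf_le_p` (`≤ 𝔅²E(2)` at the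
  half points `s < 2^{J+1}S₀` of level `J < J₀`).

The proofs are those of `Waldschmidt1980SizesB.lean`.  Everything is [folklore] book-keeping on
[cite: Waldschmidt1980, Lemma 3.2 (pp. 266–267), §3.4 (3.21)–(3.22) (pp. 269–270)].
-/

noncomputable section

open Finset Real
open Literature.NumberTheory.Transcendental
open Literature.NumberTheory.Transcendental.Baker1975
open Literature.NumberTheory.Transcendental.Baker1975.Ch3
open Literature.NumberTheory.Transcendental.CW77

namespace Literature.NumberTheory.Transcendental.CW77

namespace Setup

open Summit.ABC.StewartYu
open Summit.ABC.StewartYu.PadicW80Par (cLp' cTp cLp mRp)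

variable {S : Setup} {P : PadicW80ParL S.d} (hy : S.SizeHyp P.V P.Vθ P.W)
include hy

/-- **The bound `Amax = 𝔅⁴ E(2)` of Siegel's step** at the `p`-adic parameters:
`|D(s,τ) · qTerm| ≤ 𝔅⁴ exp(2𝔘/(2c_L'))` on the box of level `0`, `s < S₀ᵖ`, `|τ| < T`.
[cite: Waldschmidt1980, Lemma 3.2 (pp. 266–267)] -/
theorem SizeHyp.abs_Dclear_qTerm_le_pℓ {s : ℕ} (hs : s < P.S₀ℓ) {τ : Tau S.d} (hτ : tauNorm τ < P.Tℓ)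
    {u : Idx S.d P.hparℓ P.Lbℓ} (hu : u ∈ S.box (h := P.hparℓ) (Lb := P.Lbℓ) P.Lℓ P.Lθℓ 0) :
    |((S.Dclear (h := P.hparℓ) P.J₀ℓ P.Lℓ P.Lθℓ s τ : ℕ) : ℝ) *
        (S.qTerm (h := P.hparℓ) P.J₀ℓ 0 u τ s : ℝ)| ≤
      P.𝔅ℓ ^ 4 * Real.exp (2 * (P.𝔘ℓ / (2 * cLp'))) := by
  have hτ1 : τ.1 ≤ P.Tℓ := by unfold tauNorm at hτ; omega
  have hτ2 : ∑ j, τ.2 j ≤ P.Tℓ := by unfold tauNorm at hτ; omega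
  have hs' : s ≤ 2 ^ (S.d + 1 + 0) * P.S₀ℓ := by
    have : P.S₀ℓ ≤ 2 ^ (S.d + 1 + 0) * P.S₀ℓ := Nat.le_mul_of_pos_left _ (Nat.pow_pos two_pos)
    omega
  have hs1 : s ≤ 2 ^ 0 * (1 * P.S₀ℓ) := by simp; omega
  have hx : ((scale P.J₀ℓ 0 * s : ℕ) : ℝ) ≤ P.Xptℓ := S.scale_mul_le_Xptℓ P (Nat.zero_le _) hs'
  have h𝔅 := P.𝔅_pos
  -- the denominator `≤ 𝔅² E₁`
  have hD : ((S.Dclear (h := P.hparℓ) P.J₀ℓ P.Lℓ P.Lθℓ s τ : ℕ) : ℝ) ≤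
      P.𝔅ℓ ^ 2 * Real.exp (1 * (P.𝔘ℓ / (2 * cLp'))) := by
    unfold Dclear
    rw [Nat.cast_mul, Nat.cast_mul]
    have h1 : ((nuBound (scale P.J₀ℓ 0 * s) P.hparℓ ^ τ.1 : ℕ) : ℝ) ≤ P.𝔅ℓ ^ 1 := by
      rw [Nat.cast_pow, pow_one]; exact P.nuBound_pow_le_𝔅_p hx hτ1
    have h2 : ((S.bθ.natAbs ^ (∑ j, τ.2 j) : ℕ) : ℝ) ≤ P.𝔅ℓ ^ 1 := by
      rw [pow_one]; exact hy.natAbs_bθ_pow_le_pℓ hτ2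
    have h3 : (((∏ j, (S.α j).den ^ (P.Lℓ j * s)) * S.θ.den ^ (P.Lθℓ * s) : ℕ) : ℝ) ≤
        Real.exp (1 * (P.𝔘ℓ / (2 * cLp'))) := by
      have key := hy.den_prod_le_pℓ (c := 1) (e := fun j => P.Lℓ j * s) (eθ := P.Lθℓ * s)
        (fun j => by rw [one_mul]; exact Nat.mul_le_mul_left _ hs.le)
        (by rw [one_mul]; exact Nat.mul_le_mul_left _ hs.le)
      push_cast at key ⊢
      exact key
    have h12 := P.mul_le_𝔅_pow_p h1 h2 (Nat.cast_nonneg _)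
    exact mul_le_mul h12 h3 (Nat.cast_nonneg _) (by positivity)
  -- the term `≤ 𝔅² E₁`
  have hQ : |(S.qTerm (h := P.hparℓ) P.J₀ℓ 0 u τ s : ℝ)| ≤ P.𝔅ℓ ^ 2 * Real.exp (1 * (P.𝔘ℓ / (2 * cLp'))) := by
    unfold qTerm; push_cast
    rw [abs_mul, abs_mul]
    have h1 : |(S.qΔ (h := P.hparℓ) P.J₀ℓ 0 u τ.1 s : ℝ)| ≤ P.𝔅ℓ ^ 1 := by
      rw [pow_one]; exact S.abs_qΔ_le_pℓ P (Nat.zero_le _) u hs' hτ1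
    have h2 : |(S.qA u τ.2 : ℝ)| ≤ P.𝔅ℓ ^ 1 := by rw [pow_one]; exact hy.abs_qA_le_pℓ hu hτ2
    have h3 : |(S.qE u s : ℝ)| ≤ Real.exp ((1 : ℕ) * (P.𝔘ℓ / (2 * cLp'))) := hy.abs_qE_le_pℓ hu hs1
    rw [Nat.cast_one] at h3
    have h12 := P.mul_le_𝔅_pow_p h1 h2 (abs_nonneg _)
    exact mul_le_mul h12 h3 (abs_nonneg _) (by positivity)
  rw [abs_mul, Nat.abs_cast]
  calc ((S.Dclear (h := P.hparℓ) P.J₀ℓ P.Lℓ P.Lθℓ s τ : ℕ) : ℝ) * |(S.qTerm (h := P.hparℓ) P.J₀ℓ 0 u τ s : ℝ)|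
      ≤ (P.𝔅ℓ ^ 2 * Real.exp (1 * (P.𝔘ℓ / (2 * cLp')))) * (P.𝔅ℓ ^ 2 * Real.exp (1 * (P.𝔘ℓ / (2 * cLp')))) :=
        mul_le_mul hD hQ (abs_nonneg _) (by positivity)
    _ = P.𝔅ℓ ^ 4 * Real.exp (2 * (P.𝔘ℓ / (2 * cLp'))) := by
        rw [show (2 : ℝ) * (P.𝔘ℓ / (2 * cLp')) = 1 * (P.𝔘ℓ / (2 * cLp')) + 1 * (P.𝔘ℓ / (2 * cLp')) by ring,
          Real.exp_add]; ring

/-- **`|qTerm_J(u,τ,s)| ≤ 𝔅² E(2^{k+1})`** — the archimedean size of one term of `φ_{J,τ}(s)` at an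
integer point of the `k`-th inner step: box of level `J ≤ J₀ᵖ`, `|τ| ≤ T`, `s < 2^{k+1+J} S₀ᵖ`,
`k ≤ d` (`|qΔ| ≤ 𝔅`, `|qA| ≤ 𝔅`, `|qE| ≤ E(2^{k+1})`).  This is the archimedean half of the
`p`-adic Liouville estimate (product formula). [cite: Waldschmidt1980, §3.4 (3.21) (p. 269)]
[cite: Yu1990, §3 (p. 40)] -/
theorem SizeHyp.abs_qTerm_le_pℓ {J k : ℕ} (hJ : J ≤ P.J₀ℓ) (hk : k ≤ S.d) {u : Idx S.d P.hparℓ P.Lbℓ}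
    (hu : u ∈ S.box (h := P.hparℓ) (Lb := P.Lbℓ) P.Lℓ P.Lθℓ J) {τ : Tau S.d} (hτ : tauNorm τ ≤ P.Tℓ)
    {s : ℕ} (hs : s < 2 ^ (k + 1 + J) * P.S₀ℓ) :
    |(S.qTerm (h := P.hparℓ) P.J₀ℓ J u τ s : ℝ)| ≤
      P.𝔅ℓ ^ 2 * Real.exp ((2 ^ (k + 1) : ℕ) * (P.𝔘ℓ / (2 * cLp'))) := by
  have hτ1 : τ.1 ≤ P.Tℓ := by unfold tauNorm at hτ; omega
  have hτ2 : ∑ j, τ.2 j ≤ P.Tℓ := by unfold tauNorm at hτ; omega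
  have hs' : s ≤ 2 ^ (S.d + 1 + J) * P.S₀ℓ := by
    have : 2 ^ (k + 1 + J) * P.S₀ℓ ≤ 2 ^ (S.d + 1 + J) * P.S₀ℓ :=
      Nat.mul_le_mul_right _ (Nat.pow_le_pow_right two_pos (by omega))
    omega
  have hs2 : s ≤ 2 ^ J * (2 ^ (k + 1) * P.S₀ℓ) := by
    rw [← Nat.mul_assoc, ← pow_add, Nat.add_comm J (k + 1)]; exact hs.le
  unfold qTerm; push_cast
  rw [abs_mul, abs_mul]
  have h1 : |(S.qΔ (h := P.hparℓ) P.J₀ℓ J u τ.1 s : ℝ)| ≤ P.𝔅ℓ ^ 1 := by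
    rw [pow_one]; exact S.abs_qΔ_le_pℓ P hJ u hs' hτ1
  have h2 : |(S.qA u τ.2 : ℝ)| ≤ P.𝔅ℓ ^ 1 := by rw [pow_one]; exact hy.abs_qA_le_pℓ hu hτ2
  have h3 : |(S.qE u s : ℝ)| ≤ Real.exp ((2 ^ (k + 1) : ℕ) * (P.𝔘ℓ / (2 * cLp'))) := hy.abs_qE_le_pℓ hu hs2
  push_cast at h3
  have h12 := P.mul_le_𝔅_pow_p h1 h2 (abs_nonneg _)
  exact mul_le_mul h12 h3 (abs_nonneg _) (by positivity)

/-- **`D_J(s,τ) ≤ 𝔅² E(2^{k+1})`** at level `J ≤ J₀ᵖ` for the integer points `s < 2^{k+1+J} S₀ᵖ`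
(`k ≤ d`), `|τ| ≤ T`. [cite: Waldschmidt1980, §3.4 (3.21) (p. 269)] -/
theorem SizeHyp.DclearJ_le_pℓ {J k : ℕ} (hJ : J ≤ P.J₀ℓ) (hk : k ≤ S.d) {τ : Tau S.d} (hτ : tauNorm τ ≤ P.Tℓ)
    {s : ℕ} (hs : s < 2 ^ (k + 1 + J) * P.S₀ℓ) :
    ((S.DclearJ (h := P.hparℓ) P.J₀ℓ J P.Lℓ P.Lθℓ s τ : ℕ) : ℝ) ≤
      P.𝔅ℓ ^ 2 * Real.exp ((2 ^ (k + 1) : ℕ) * (P.𝔘ℓ / (2 * cLp'))) := by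
  have hτ1 : τ.1 ≤ P.Tℓ := by unfold tauNorm at hτ; omega
  have hτ2 : ∑ j, τ.2 j ≤ P.Tℓ := by unfold tauNorm at hτ; omega
  have hs' : s ≤ 2 ^ (S.d + 1 + J) * P.S₀ℓ := by
    have : 2 ^ (k + 1 + J) * P.S₀ℓ ≤ 2 ^ (S.d + 1 + J) * P.S₀ℓ :=
      Nat.mul_le_mul_right _ (Nat.pow_le_pow_right two_pos (by omega))
    omega
  have hx : ((scale P.J₀ℓ J * s : ℕ) : ℝ) ≤ P.Xptℓ := S.scale_mul_le_Xptℓ P hJ hs'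
  unfold DclearJ
  rw [Nat.cast_mul, Nat.cast_mul]
  have h1 : ((nuBound (scale P.J₀ℓ J * s) P.hparℓ ^ τ.1 : ℕ) : ℝ) ≤ P.𝔅ℓ ^ 1 := by
    rw [Nat.cast_pow, pow_one]; exact P.nuBound_pow_le_𝔅_p hx hτ1
  have h2 : ((S.bθ.natAbs ^ (∑ j, τ.2 j) : ℕ) : ℝ) ≤ P.𝔅ℓ ^ 1 := by
    rw [pow_one]; exact hy.natAbs_bθ_pow_le_pℓ hτ2
  have hdiv : ∀ Lq : ℕ, Lq / 2 ^ J * s ≤ 2 ^ (k + 1) * Lq * P.S₀ℓ := by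
    intro Lq
    calc Lq / 2 ^ J * s ≤ (Lq / 2 ^ J) * (2 ^ (k + 1 + J) * P.S₀ℓ) := Nat.mul_le_mul_left _ hs.le
      _ = 2 ^ (k + 1) * ((Lq / 2 ^ J) * 2 ^ J) * P.S₀ℓ := by rw [pow_add]; ring
      _ ≤ 2 ^ (k + 1) * Lq * P.S₀ℓ := by
          have := Nat.div_mul_le_self Lq (2 ^ J)
          exact Nat.mul_le_mul_right _ (Nat.mul_le_mul_left _ this)
  have h3 : (((∏ j, (S.α j).den ^ (P.Lℓ j / 2 ^ J * s)) * S.θ.den ^ (P.Lθℓ / 2 ^ J * s) : ℕ) : ℝ) ≤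
      Real.exp ((2 ^ (k + 1) : ℕ) * (P.𝔘ℓ / (2 * cLp'))) :=
    hy.den_prod_le_pℓ (c := 2 ^ (k + 1)) (fun j => hdiv (P.Lℓ j)) (hdiv P.Lθℓ)
  have h12 := P.mul_le_𝔅_pow_p h1 h2 (Nat.cast_nonneg _)
  exact mul_le_mul h12 h3 (Nat.cast_nonneg _) (by positivity)

/-- **`|rHalf| ≤ 𝔅² E(2)`** on the box of level `J < J₀ᵖ`, `|τ| ≤ T`, `s < 2^{J+1} S₀ᵖ`.
[cite: Waldschmidt1980, §3.4 (3.22) (p. 270)] -/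
theorem SizeHyp.abs_rHalf_le_pℓ {J : ℕ} (hJ : J < P.J₀ℓ) {u : Idx S.d P.hparℓ P.Lbℓ}
    (hu : u ∈ S.box (h := P.hparℓ) (Lb := P.Lbℓ) P.Lℓ P.Lθℓ J) {τ : Tau S.d} (hτ : tauNorm τ ≤ P.Tℓ)
    {s : ℕ} (hs : s < 2 ^ (J + 1) * P.S₀ℓ) :
    |(S.rHalf (h := P.hparℓ) P.J₀ℓ J u τ s : ℝ)| ≤ P.𝔅ℓ ^ 2 * Real.exp (2 * (P.𝔘ℓ / (2 * cLp'))) := by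
  have hτ1 : τ.1 ≤ P.Tℓ := by unfold tauNorm at hτ; omega
  have hτ2 : ∑ j, τ.2 j ≤ P.Tℓ := by unfold tauNorm at hτ; omega
  have hs' : s ≤ 2 ^ (S.d + 1 + (J + 1)) * P.S₀ℓ := by
    have : 2 ^ (J + 1) * P.S₀ℓ ≤ 2 ^ (S.d + 1 + (J + 1)) * P.S₀ℓ :=
      Nat.mul_le_mul_right _ (Nat.pow_le_pow_right two_pos (by omega))
    omega
  have hs2 : s ≤ 2 ^ J * (2 * P.S₀ℓ) := by rw [← Nat.mul_assoc, ← pow_succ]; exact hs.le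
  unfold rHalf; push_cast
  rw [abs_mul, abs_mul]
  have h1 : |(S.qΔ (h := P.hparℓ) P.J₀ℓ (J + 1) u τ.1 s : ℝ)| ≤ P.𝔅ℓ ^ 1 := by
    rw [pow_one]; exact S.abs_qΔ_le_pℓ P hJ u hs' hτ1
  have h2 : |(S.qA u τ.2 : ℝ)| ≤ P.𝔅ℓ ^ 1 := by rw [pow_one]; exact hy.abs_qA_le_pℓ hu hτ2
  have h3 : |(S.qEh u s : ℝ)| ≤ Real.exp ((2 : ℕ) * (P.𝔘ℓ / (2 * cLp'))) := hy.abs_qEh_le_pℓ hu hs2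
  rw [Nat.cast_ofNat] at h3
  have h12 := P.mul_le_𝔅_pow_p h1 h2 (abs_nonneg _)
  exact mul_le_mul h12 h3 (abs_nonneg _) (by positivity)

/-- **`Dhalf ≤ 𝔅² E(2)`** for `J < J₀ᵖ`, `|τ| ≤ T`, `s < 2^{J+1} S₀ᵖ`.
[cite: Waldschmidt1980, §3.4 (3.22) (p. 270)] -/
theorem SizeHyp.Dhalf_le_pℓ {J : ℕ} (hJ : J < P.J₀ℓ) {τ : Tau S.d} (hτ : tauNorm τ ≤ P.Tℓ)
    {s : ℕ} (hs : s < 2 ^ (J + 1) * P.S₀ℓ) :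
    ((S.Dhalf (h := P.hparℓ) P.J₀ℓ J P.Lℓ P.Lθℓ s τ : ℕ) : ℝ) ≤
      P.𝔅ℓ ^ 2 * Real.exp (2 * (P.𝔘ℓ / (2 * cLp'))) := by
  have hτ1 : τ.1 ≤ P.Tℓ := by unfold tauNorm at hτ; omega
  have hτ2 : ∑ j, τ.2 j ≤ P.Tℓ := by unfold tauNorm at hτ; omega
  have hs' : s ≤ 2 ^ (S.d + 1 + (J + 1)) * P.S₀ℓ := by
    have : 2 ^ (J + 1) * P.S₀ℓ ≤ 2 ^ (S.d + 1 + (J + 1)) * P.S₀ℓ :=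
      Nat.mul_le_mul_right _ (Nat.pow_le_pow_right two_pos (by omega))
    omega
  have hx : ((scale P.J₀ℓ (J + 1) * s : ℕ) : ℝ) ≤ P.Xptℓ := S.scale_mul_le_Xptℓ P hJ hs'
  unfold Dhalf
  rw [Nat.cast_mul, Nat.cast_mul]
  have h1 : ((nuBound (scale P.J₀ℓ (J + 1) * s) P.hparℓ ^ τ.1 : ℕ) : ℝ) ≤ P.𝔅ℓ ^ 1 := by
    rw [Nat.cast_pow, pow_one]; exact P.nuBound_pow_le_𝔅_p hx hτ1
  have h2 : ((S.bθ.natAbs ^ (∑ j, τ.2 j) : ℕ) : ℝ) ≤ P.𝔅ℓ ^ 1 := by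
    rw [pow_one]; exact hy.natAbs_bθ_pow_le_pℓ hτ2
  have hdiv : ∀ Lq : ℕ, Lq / 2 ^ J * s ≤ 2 * Lq * P.S₀ℓ := by
    intro Lq
    calc Lq / 2 ^ J * s ≤ (Lq / 2 ^ J) * (2 ^ (J + 1) * P.S₀ℓ) := Nat.mul_le_mul_left _ hs.le
      _ = 2 * ((Lq / 2 ^ J) * 2 ^ J) * P.S₀ℓ := by rw [pow_succ]; ring
      _ ≤ 2 * Lq * P.S₀ℓ := by
          have := Nat.div_mul_le_self Lq (2 ^ J)
          exact Nat.mul_le_mul_right _ (Nat.mul_le_mul_left _ this)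
  have h3 : (((∏ j, (S.α j).den ^ (P.Lℓ j / 2 ^ J * s)) * S.θ.den ^ (P.Lθℓ / 2 ^ J * s) : ℕ) : ℝ) ≤
      Real.exp (2 * (P.𝔘ℓ / (2 * cLp'))) := by
    have := hy.den_prod_le_pℓ (c := 2) (fun j => hdiv (P.Lℓ j)) (hdiv P.Lθℓ)
    push_cast at this ⊢
    exact this
  have h12 := P.mul_le_𝔅_pow_p h1 h2 (Nat.cast_nonneg _)
  exact mul_le_mul h12 h3 (Nat.cast_nonneg _) (by positivity)

end Setup

end Literature.NumberTheory.Transcendental.CW77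

end

/-!
# p2's inputs `KSizes`, `Siegel`, `Endgame` in CLOSED FORM at the `(log p)`-normalised record `PadicW80ParL`

Support file (theorems only; no named fact), cell `abc-stewartyu` (p1, stub S5 of memo-03 §4): twin of the
record-dependent half of p3's `PadicCW77Sizes.lean` (`kSizes_of_hypℓ`, `siegel_of_hypℓ`, `endgame_of_paramsℓ`,
`four_mul_kptsℓ`) and of `PadicCW77Junctions.lean` (`hSizesHalf_of_hypℓ`) on `PadicW80ParL`; the record-free junction lemmas (`inv_iff`, `abs_cast_qTerm_eq_flat`,
`exists_int_flatDclearJ_mul_coreSum`) are imported from the landed file. Inputs: `PadicW80SizesL{,H,B,C}`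
(archimedean sizes), `PadicW80BudgetsL` (closed forms), `PadicW80ParLF` (`padic_siegel_count`, `endgame_numbers`).
Everything is [folklore].
-/

noncomputable section

open Finset
open Literature.NumberTheory.Transcendental
open Literature.NumberTheory.Transcendental.CW77 (heightProd hgt)
open Literature.NumberTheory.Transcendental.CW77.Setup (Idx Tau tauNorm tauSet)

namespace Literature.NumberTheory.Transcendental.PadicCW77.Setup

open Summit.ABC.StewartYu
open Summit.ABC.StewartYu.PadicW80Par (cLp')

variable {S : PadicCW77.Setup}
variable {P : PadicW80ParL S.d} (hy : S.toQ.flat.SizeHyp P.V P.Vθ P.W)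
include hy

/-! ### J2 (inner steps): `KSizes` in closed form -/

omit hy in
/-- `4 · (2^{k+J} S₀ / 2) = 2^{k+1+J} S₀` (`S₀` is even). [folklore] -/
theorem four_mul_kptsℓ (P : PadicW80ParL S.d) (J k : ℕ) :
    4 * (2 ^ (k + J) * P.S₀ℓ / 2) = 2 ^ (k + 1 + J) * P.S₀ℓ := by
  obtain ⟨m, hm⟩ := P.even_S₀
  rw [hm, ← two_mul, show 2 ^ (k + J) * (2 * m) = 2 ^ (k + J) * m * 2 by ring,
    Nat.mul_div_cancel _ two_pos]
  ring

/-- **J2, the archimedean sizes of the inner steps in closed form.** For coefficients `p` of level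
`J < J₀` with `|p(u)| ≤ Pint ≤ PrV`: at step `k < d`, `|τ| + t ≤ T/2^J − kt`, odd `s₁ < 2^{k+1+J}S₀`,
the integer `D = DclearJ♭(s₁,τ) ≤ Dmax_k` clears `coreSum` and `|coreSum| ≤ Mmax_k`. [folklore] -/
theorem kSizes_of_hypℓ {J : ℕ} (hJ : J < P.J₀ℓ) (t : ℕ) {Pint : ℤ} (hPint : (Pint : ℝ) ≤ P.PrVℓ)
    {p : Idx S.d P.hparℓ P.Lbℓ → ℤ} (inv : S.Inv P.J₀ℓ P.Lℓ P.Lθℓ P.S₀ℓ P.Tℓ Pint J p) :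
    S.KSizes P.J₀ℓ J P.Lℓ P.Lθℓ P.S₀ℓ P.Tℓ t p P.DmaxKℓ P.MmaxKℓ := by
  classical
  intro k hk τ hτ s₁ hs₁ _hodd
  have hPr : (0 : ℝ) ≤ P.PrVℓ := by linarith [P.one_le_PrVp]
  have hτT : tauNorm τ ≤ P.Tℓ := by have := Nat.div_le_self P.Tℓ (2 ^ J); omega
  have hs4 : s₁ < 2 ^ (k + 1 + J) * P.S₀ℓ := by rw [← four_mul_kptsℓ P J k]; exact hs₁
  have hB0 : 0 ≤ P.DmaxKℓ k := (P.DmaxK_pos k).le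
  refine ⟨S.toQ.flat.DclearJ (h := P.hparℓ) P.J₀ℓ J P.Lℓ P.Lθℓ s₁ τ, S.toQ.flat.DclearJ_pos _ _ _ _ _ _,
    ?_, S.exists_int_flatDclearJ_mul_coreSum P.J₀ℓ J P.Lℓ P.Lθℓ p τ s₁, ?_⟩
  · have := hy.DclearJ_le_pℓ hJ.le hk.le hτT hs4
    unfold PadicW80ParL.DmaxKℓ PadicW80ParL.Efacℓ; exact this
  · have hterm : ∀ u ∈ S.frame.box (h := P.hparℓ) (Lb := P.Lbℓ) P.Lℓ P.Lθℓ J,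
        |(p u : ℝ)| * |(S.qTerm P.J₀ℓ J u τ s₁ : ℝ)| ≤ P.PrVℓ * P.DmaxKℓ k := by
      intro u hu
      have hq : |(S.qTerm P.J₀ℓ J u τ s₁ : ℝ)| ≤ P.DmaxKℓ k := by
        rw [S.abs_cast_qTerm_eq_flat]
        have := hy.abs_qTerm_le_pℓ hJ.le hk.le (u := u) hu hτT hs4
        unfold PadicW80ParL.DmaxKℓ PadicW80ParL.Efacℓ; exact this
      have hp : |(p u : ℝ)| ≤ P.PrVℓ := le_trans (by exact_mod_cast inv.bound u) hPint
      exact mul_le_mul hp hq (abs_nonneg _) hPr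
    have hcard : ((S.frame.box (h := P.hparℓ) (Lb := P.Lbℓ) P.Lℓ P.Lθℓ J).card : ℝ) ≤ P.𝔅ℓ :=
      S.toQ.flat.card_box_le_𝔅_pℓ P J
    show |((S.coreSum P.J₀ℓ J _ p τ s₁ : ℚ) : ℝ)| ≤ P.MmaxKℓ k
    unfold coreSum PadicW80ParL.MmaxKℓ
    push_cast
    calc |∑ u ∈ S.frame.box (h := P.hparℓ) (Lb := P.Lbℓ) P.Lℓ P.Lθℓ J, (p u : ℝ) * (S.qTerm P.J₀ℓ J u τ s₁ : ℝ)|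
        ≤ ∑ u ∈ S.frame.box (h := P.hparℓ) (Lb := P.Lbℓ) P.Lℓ P.Lθℓ J, |(p u : ℝ) * (S.qTerm P.J₀ℓ J u τ s₁ : ℝ)| :=
          abs_sum_le_sum_abs _ _
      _ ≤ ∑ u ∈ S.frame.box (h := P.hparℓ) (Lb := P.Lbℓ) P.Lℓ P.Lθℓ J, P.PrVℓ * P.DmaxKℓ k :=
          sum_le_sum fun u hu => by rw [abs_mul]; exact hterm u hu
      _ = (S.frame.box (h := P.hparℓ) (Lb := P.Lbℓ) P.Lℓ P.Lθℓ J).card * (P.PrVℓ * P.DmaxKℓ k) := by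
          rw [sum_const, nsmul_eq_mul]
      _ ≤ P.𝔅ℓ * (P.PrVℓ * P.DmaxKℓ k) := mul_le_mul_of_nonneg_right hcard (mul_nonneg hPr hB0)
      _ = P.𝔅ℓ * P.PrVℓ * P.DmaxKℓ k := by ring

/-! ### Siegel and the endgame at p1's parameters, via the sign-free descent files -/

/-- **The input `Siegel` in closed form**: integers `p(u)` of level `0`, `|p(u)| ≤ ⌈#box₀ · 𝔅⁴E(2)⌉`
(`SetupQ.siegel_step` with the count `padic_siegel_count` and `Amax = 𝔅⁴E(2)` from
`abs_Dclear_qTerm_le_p`). [folklore] -/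
theorem siegel_of_hypℓ :
    S.Siegel (h := P.hparℓ) (Lb := P.Lbℓ) P.J₀ℓ P.Lℓ P.Lθℓ P.S₀ℓ P.Tℓ
      ⌈((S.frame.box (h := P.hparℓ) (Lb := P.Lbℓ) P.Lℓ P.Lθℓ 0).card : ℝ) * (P.𝔅ℓ ^ 4 * P.Efacℓ 2)⌉ := by
  have hS₀ : 1 ≤ P.S₀ℓ := le_trans (by norm_num) P.two_le_S₀
  have hAmax : 1 ≤ P.𝔅ℓ ^ 4 * P.Efacℓ 2 :=
    one_le_mul_of_one_le_of_one_le (one_le_pow₀ P.one_le_𝔅) (P.one_le_Efacp (by norm_num))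
  have hA : ∀ s, s < P.S₀ℓ → ∀ τ : Tau S.d, tauNorm τ < P.Tℓ →
      ∀ u ∈ S.toQ.flat.box (h := P.hparℓ) (Lb := P.Lbℓ) P.Lℓ P.Lθℓ 0,
      |((S.toQ.flat.Dclear (h := P.hparℓ) P.J₀ℓ P.Lℓ P.Lθℓ s τ : ℕ) : ℝ) * (S.toQ.qTerm P.J₀ℓ 0 u τ s : ℝ)| ≤
        P.𝔅ℓ ^ 4 * P.Efacℓ 2 := by
    intro s hs τ hτ u hu
    rw [abs_mul, S.toQ_qTerm, S.abs_cast_qTerm_eq_flat, ← abs_mul]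
    have := hy.abs_Dclear_qTerm_le_pℓ hs hτ hu
    unfold PadicW80ParL.Efacℓ; exact this
  obtain ⟨p, hp⟩ := S.toQ.siegel_step P.J₀ℓ P.Lℓ P.Lθℓ P.S₀ℓ P.Tℓ hS₀ P.one_le_T
    (PadicW80ParL.padic_siegel_count S.toQ.flat P) hAmax hA
  exact ⟨p, (S.inv_iff).mpr hp⟩

omit hy in
/-- **The input `Endgame` at p1's parameters** (`SetupQ.w80_endgame` with p1's `endgame_numbers` and
`Lθ_lt_two_pow`). [folklore] -/
theorem endgame_of_paramsℓ (P : PadicW80ParL S.d) (Pint : ℤ) :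
    S.Endgame (h := P.hparℓ) (Lb := P.Lbℓ) P.J₀ℓ P.Lℓ P.Lθℓ P.S₀ℓ P.Tℓ Pint := by
  intro p inv
  obtain ⟨h1, h2⟩ := P.endgame_numbers
  have hT' : (P.Tℓ / 2 ^ P.J₀ℓ - ∑ j, P.Lℓ j / 2 ^ P.J₀ℓ) + ∑ j, P.Lℓ j / 2 ^ P.J₀ℓ ≤ P.Tℓ / 2 ^ P.J₀ℓ := by
    omega
  exact S.toQ.w80_endgame ((S.inv_iff).mp inv) P.Lθ_lt_two_pow
    (T' := P.Tℓ / 2 ^ P.J₀ℓ - ∑ j, P.Lℓ j / 2 ^ P.J₀ℓ) hT' h2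

/-! ### J2 at the half points: `HSizesHalf` in closed form (twin of `hSizesHalf_of_hyp`) -/

/-- **J2, the archimedean sizes at the half points in closed form** at the `ℓ`-normalised record:
`Dhalf♭ ≤ DmaxH` and `∑_{T'}|classVec(T')| ≤ MmaxH` for every `p` of level `J < J₀` with `|p| ≤ Pint ≤ PrV`.
[folklore] -/
theorem hSizesHalf_of_hypℓ {J : ℕ} (hJ : J < P.J₀ℓ) {Pint : ℤ} (hPint : (Pint : ℝ) ≤ P.PrVℓ) :
    S.HSizesHalf (h := P.hparℓ) (Lb := P.Lbℓ) P.J₀ℓ J P.Lℓ P.Lθℓ P.S₀ℓ P.Tℓ Pint P.DmaxHℓ P.MmaxHℓ := by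
  refine ⟨P.one_le_MmaxHp, ?_⟩
  intro p inv s hs _hodd τ hτ
  have hPr : (0 : ℝ) ≤ P.PrVℓ := by linarith [P.one_le_PrVp]
  have hτT : tauNorm τ ≤ P.Tℓ := by have := Nat.div_le_self P.Tℓ (2 ^ (J + 1)); omega
  refine ⟨?_, ?_⟩
  · have := hy.Dhalf_le_pℓ hJ hτT hs
    unfold PadicW80ParL.DmaxHℓ PadicW80ParL.Efacℓ; exact this
  · have hcard : ((S.toQ.flat.box (h := P.hparℓ) (Lb := P.Lbℓ) P.Lℓ P.Lθℓ J).card : ℝ) ≤ P.𝔅ℓ :=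
      S.toQ.flat.card_box_le_𝔅_pℓ P J
    have key := S.toQ.sum_abs_classVec_le_card P.J₀ℓ J (S.toQ.flat.box (h := P.hparℓ) (Lb := P.Lbℓ) P.Lℓ P.Lθℓ J)
      p τ s (Rmax := P.DmaxHℓ) hPr
      (fun u _ => le_trans (by exact_mod_cast inv.bound u) hPint)
      (fun u hu => by
        rw [S.abs_cast_rHalf_eq_flat]
        have := hy.abs_rHalf_le_pℓ hJ hu hτT hs
        unfold PadicW80ParL.DmaxHℓ PadicW80ParL.Efacℓ; exact this)
    refine key.trans ?_
    have hR0 : (0 : ℝ) ≤ P.DmaxHℓ := by linarith [P.one_le_DmaxHp]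
    unfold PadicW80ParL.MmaxHℓ
    exact mul_le_mul_of_nonneg_right (mul_le_mul_of_nonneg_right hcard hPr) hR0

end Literature.NumberTheory.Transcendental.PadicCW77.Setup

end
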